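import Mathlib.RingTheory.Derivation.Basic
import Literature.NumberTheory.GaloisCohomology.PBasis
import HarnessLib

/-!
# The partial derivatives attached to a finite `p`-basis

For a ring `R` of characteristic `p` with a finite `p`-basis `t : ι → R` (`IsPBasis p t`, file `PBasis.lean`:
every `x` is uniquely `∑_α c_α ^ p * t^α`), the **partial derivative** `∂_i` (`i : ι`) is the additive map

  `∂_i (∑_α c_α ^ p * t^α) = ∑_α c_α ^ p * α_i * t^(α - e_i)`

(Matsumura, §26: "extend `D` to `K` as a `K^p`-linear map; then `D` is a derivation").  We construct it
from the basis (`IsPBasis.pderiv h i : Derivation ℤ R R`), prove the Leibniz rule by reduction to monomials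
with NATURAL exponents (`prodPow t e = ∏ j, t j ^ e j`, `pderiv_prodPow : ∂_i (∏ t_j^{e_j}) = e_i * ∏ t_j^{e_j - δ_ij}`),
and record `∂_i (t j) = δ_ij` (`pderiv_apply_self/of_ne`), `∂_i (c ^ p * x) = c ^ p * ∂_i x` (`pderiv_pow_mul`).
Consequence (file `PBasisKaehler.lean`): the `D t_i` form an `R`-basis of `Ω[R⁄ℤ]`.

## References

* H. Matsumura, *Commutative Ring Theory*, CUP, §26 (p-bases; Thm. 26.5). [Matsumura1987]
-/

noncomputable section

open scoped BigOperators

namespace Literature.NumberTheory.GaloisCohomology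

universe u v

variable (p : ℕ) [hp : Fact p.Prime] {R : Type u} [CommRing R] [CharP R p] {ι : Type v} [Fintype ι]

/-! ### Monomials with natural exponents -/

omit hp [CharP R p] in
/-- `∏ j, t j ^ e j` for natural exponents `e : ι → ℕ`. [folklore] -/
def prodPow (t : ι → R) (e : ι → ℕ) : R :=
  ∏ j, t j ^ e j

omit hp [CharP R p] in
/-- A `p`-monomial is a `prodPow` with exponents `< p`. [folklore] -/
theorem pMonomial_eq_prodPow (t : ι → R) (α : ι → Fin p) :
    pMonomial p t α = prodPow t fun j => (α j : ℕ) :=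
  rfl

omit hp [CharP R p] in
/-- `prodPow` is multiplicative in the exponent. [folklore] -/
theorem prodPow_mul_prodPow (t : ι → R) (a b : ι → ℕ) :
    prodPow t a * prodPow t b = prodPow t (a + b) := by
  unfold prodPow
  rw [← Finset.prod_mul_distrib]
  exact Finset.prod_congr rfl fun j _ => by rw [Pi.add_apply, pow_add]

omit hp [CharP R p] in
/-- `prodPow t 0 = 1`. [folklore] -/
@[simp] theorem prodPow_zero (t : ι → R) : prodPow t 0 = 1 := by
  simp [prodPow]

omit hp [CharP R p] in
/-- `prodPow t (Pi.single i 1) = t i`. [folklore] -/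
theorem prodPow_single_one [DecidableEq ι] (t : ι → R) (i : ι) : prodPow t (Pi.single i 1) = t i := by
  unfold prodPow
  rw [Finset.prod_eq_single i (fun j _ hj => by rw [Pi.single_eq_of_ne hj, pow_zero])
    (fun h => (h (Finset.mem_univ i)).elim), Pi.single_eq_same, pow_one]

/-- The exponent vector `e % p`, valued in `Fin p`. [folklore] -/
def modExp (e : ι → ℕ) : ι → Fin p := fun j => ⟨e j % p, Nat.mod_lt _ hp.out.pos⟩

omit [CharP R p] [Fintype ι] in
/-- `(modExp p e j : ℕ) = e j % p`. [folklore] -/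
@[simp] theorem val_modExp (e : ι → ℕ) (j : ι) : (modExp p e j : ℕ) = e j % p := rfl

omit [CharP R p] in
/-- **Euclidean division of a monomial**: `∏ t_j^{e_j} = (∏ t_j^{e_j / p}) ^ p * t^(e % p)`. [folklore] -/
theorem prodPow_eq_pow_mul_pMonomial (t : ι → R) (e : ι → ℕ) :
    prodPow t e = prodPow t (fun j => e j / p) ^ p * pMonomial p t (modExp p e) := by
  unfold prodPow pMonomial
  rw [← Finset.prod_pow, ← Finset.prod_mul_distrib]
  refine Finset.prod_congr rfl fun j _ => ?_
  rw [← pow_mul, ← pow_add, val_modExp, Nat.div_add_mod']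

namespace IsPBasis

variable {p} {t : ι → R} [DecidableEq ι]

/-! ### The partial derivative `∂_i` as a twisted-linear map, and on monomials -/

/-- The partial derivative `∂_i` on the Frobenius twist: the `R`-linear (i.e. `c^p`-linear) endomorphism of
`FrobeniusTwist p R R` with `t^α ↦ α_i * t^(α - e_i)`. [cite: Matsumura1987, §26] -/
def pderivTwist (h : IsPBasis p t) (i : ι) : FrobeniusTwist p R R →ₗ[R] FrobeniusTwist p R R :=
  h.basis.constr ℤ fun α =>
    FrobeniusTwist.of p R (((α i : ℕ) : R) * pMonomial p t (α - Pi.single i 1))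

/-- The partial derivative `∂_i : R → R` as a function. [cite: Matsumura1987, §26] -/
def pderivFun (h : IsPBasis p t) (i : ι) (x : R) : R :=
  (FrobeniusTwist.of p R).symm (h.pderivTwist i (FrobeniusTwist.of p R x))

/-- `∂_i` is additive. [folklore] -/
theorem pderivFun_add (h : IsPBasis p t) (i : ι) (x y : R) :
    h.pderivFun i (x + y) = h.pderivFun i x + h.pderivFun i y := by
  simp only [pderivFun, map_add]

/-- `∂_i (c ^ p * x) = c ^ p * ∂_i x`. [folklore] -/
theorem pderivFun_pow_mul (h : IsPBasis p t) (i : ι) (c x : R) :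
    h.pderivFun i (c ^ p * x) = c ^ p * h.pderivFun i x := by
  simp only [pderivFun]
  rw [← FrobeniusTwist.smul_of_eq_of_pow_mul, map_smul, FrobeniusTwist.of_symm_smul, smul_eq_mul]

/-- `∂_i (t^α) = α_i * t^(α - e_i)` on `p`-monomials. [cite: Matsumura1987, §26] -/
theorem pderivFun_pMonomial (h : IsPBasis p t) (i : ι) (α : ι → Fin p) :
    h.pderivFun i (pMonomial p t α) = ((α i : ℕ) : R) * pMonomial p t (α - Pi.single i 1) := by
  simp only [pderivFun]
  rw [← pMonomialTwist, ← h.basis_apply, pderivTwist, Module.Basis.constr_basis]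
  rfl

omit hp [CharP R p] [Fintype ι] in
/-- Pointwise description of `e - Pi.single i 1` away from `i`. [folklore] -/
private theorem sub_single_apply_of_ne (e : ι → ℕ) {i j : ι} (h : j ≠ i) :
    (e - Pi.single i 1 : ι → ℕ) j = e j := by
  rw [Pi.sub_apply, Pi.single_eq_of_ne h, Nat.sub_zero]

/-- **`∂_i` on monomials with natural exponents**: `∂_i (∏ t_j^{e_j}) = e_i * ∏ t_j^{(e - δ_i)_j}`
(when `e_i = 0` the right-hand side vanishes because of the factor `(e_i : R) = 0`). [cite: Matsumura1987, §26] -/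
theorem pderivFun_prodPow (h : IsPBasis p t) (i : ι) (e : ι → ℕ) :
    h.pderivFun i (prodPow t e) = ((e i : ℕ) : R) * prodPow t (e - Pi.single i 1) := by
  -- the coefficient: `(e i % p : R) = (e i : R)`
  have hcoef : (((modExp p e) i : ℕ) : R) = ((e i : ℕ) : R) := by
    rw [val_modExp]
    exact (CharP.cast_eq_mod R p (e i)).symm
  rw [prodPow_eq_pow_mul_pMonomial p t e, pderivFun_pow_mul, pderivFun_pMonomial, hcoef]
  by_cases h0 : e i % p = 0
  · -- both sides vanish
    have : ((e i : ℕ) : R) = 0 := by rw [CharP.cast_eq_mod R p, h0, Nat.cast_zero]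
    rw [this, zero_mul, zero_mul, mul_zero]
  · rw [mul_left_comm]
    congr 1
    -- `∏ t^{(e - δ_i)} = (∏ t^{e/p})^p * t^{(e % p) - δ_i}`
    rw [prodPow_eq_pow_mul_pMonomial p t (e - Pi.single i 1)]
    have hq : (fun j => (e - Pi.single i 1 : ι → ℕ) j / p) = fun j => e j / p := by
      funext j
      by_cases hj : j = i
      · subst hj
        rw [Pi.sub_apply, Pi.single_eq_same]
        -- `(e j - 1) / p = e j / p` because `p ∤ e j`
        have h1 : 0 < e j % p := Nat.pos_of_ne_zero h0
        conv_rhs => rw [← Nat.div_add_mod (e j) p]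
        conv_lhs => rw [← Nat.div_add_mod (e j) p]
        have h2 : (e j % p - 1) / p = 0 :=
          Nat.div_eq_of_lt (by have := Nat.mod_lt (e j) hp.out.pos; omega)
        have h3 : e j % p / p = 0 := Nat.div_eq_of_lt (Nat.mod_lt (e j) hp.out.pos)
        rw [Nat.add_sub_assoc h1, Nat.mul_add_div hp.out.pos, Nat.mul_add_div hp.out.pos, h2, h3]
      · rw [sub_single_apply_of_ne e hj]
    have hr : modExp p (e - Pi.single i 1) = modExp p e - Pi.single i 1 := by
      funext j
      apply Fin.ext
      by_cases hj : j = i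
      · subst hj
        rw [val_modExp, Pi.sub_apply, Pi.single_eq_same, Pi.sub_apply, Pi.single_eq_same,
          Fin.sub_val_of_le (by
            change ((1 : Fin p) : ℕ) ≤ e j % p
            rw [Fin.val_one', Nat.one_mod_eq_one.mpr hp.out.one_lt.ne']
            exact Nat.pos_of_ne_zero h0)]
        rw [val_modExp, Fin.val_one', Nat.one_mod_eq_one.mpr hp.out.one_lt.ne']
        have h1 : 0 < e j % p := Nat.pos_of_ne_zero h0
        conv_lhs => rw [← Nat.div_add_mod (e j) p, Nat.add_sub_assoc h1, Nat.mul_add_mod]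
        exact Nat.mod_eq_of_lt (by have := Nat.mod_lt (e j) hp.out.pos; omega)
      · rw [val_modExp, sub_single_apply_of_ne e hj, Pi.sub_apply, Pi.single_eq_of_ne hj, sub_zero,
          val_modExp]
    rw [hq, hr]

omit hp [CharP R p] [Fintype ι] in
/-- Exponent bookkeeping for the Leibniz rule: `a + b - δ_i = a + (b - δ_i)` when `b_i ≠ 0`. [folklore] -/
private theorem add_sub_single_of_ne_zero (a b : ι → ℕ) (i : ι) (hb : b i ≠ 0) :
    a + b - Pi.single i 1 = a + (b - Pi.single i 1) := by
  funext j
  by_cases hj : j = i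
  · subst hj
    simp only [Pi.sub_apply, Pi.add_apply, Pi.single_eq_same]
    omega
  · simp only [Pi.sub_apply, Pi.add_apply, Pi.single_eq_of_ne hj, Nat.sub_zero]

/-- Leibniz rule for `∂_i` on two monomials with natural exponents. [folklore] -/
theorem pderivFun_prodPow_mul_prodPow (h : IsPBasis p t) (i : ι) (a b : ι → ℕ) :
    h.pderivFun i (prodPow t a * prodPow t b) =
      prodPow t a * h.pderivFun i (prodPow t b) + prodPow t b * h.pderivFun i (prodPow t a) := by
  rw [prodPow_mul_prodPow, pderivFun_prodPow, pderivFun_prodPow, pderivFun_prodPow, Pi.add_apply,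
    Nat.cast_add, add_comm ((a i : ℕ) : R), add_mul]
  congr 1
  · by_cases hb : b i = 0
    · rw [hb, Nat.cast_zero, zero_mul, zero_mul, mul_zero]
    · rw [add_sub_single_of_ne_zero a b i hb, ← prodPow_mul_prodPow, mul_left_comm]
  · by_cases ha : a i = 0
    · rw [ha, Nat.cast_zero, zero_mul, zero_mul, mul_zero]
    · rw [add_comm a b, add_sub_single_of_ne_zero b a i ha, ← prodPow_mul_prodPow, mul_left_comm,
        mul_comm (prodPow t b)]

/-- **Leibniz rule** for `∂_i`: `∂_i (x y) = x ∂_i y + y ∂_i x` — by twisted bilinearity it reduces to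
`p`-monomials, i.e. to `pderivFun_prodPow_mul_prodPow`. [cite: Matsumura1987, §26] -/
theorem pderivFun_mul (h : IsPBasis p t) (i : ι) (x y : R) :
    h.pderivFun i (x * y) = x * h.pderivFun i y + y * h.pderivFun i x := by
  induction x using h.induction_on with
  | monomial α =>
    induction y using h.induction_on with
    | monomial β =>
      rw [pMonomial_eq_prodPow, pMonomial_eq_prodPow]
      exact h.pderivFun_prodPow_mul_prodPow i _ _
    | add y z hy hz => rw [mul_add, pderivFun_add, hy, hz, pderivFun_add]; ring
    | pow_mul c y hy =>
      rw [mul_left_comm, pderivFun_pow_mul, hy, pderivFun_pow_mul]; ring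
    | zero => simp [pderivFun, map_zero]
  | add x z hx hz => rw [add_mul, pderivFun_add, hx, hz, pderivFun_add]; ring
  | pow_mul c x hx => rw [mul_assoc, pderivFun_pow_mul, hx, pderivFun_pow_mul]; ring
  | zero => simp [pderivFun, map_zero]

/-! ### `∂_i` as a derivation -/

/-- **The partial derivative `∂_i : Derivation ℤ R R` attached to a finite `p`-basis** (`t^α ↦ α_i t^(α - e_i)`,
extended `c^p`-linearly). [cite: Matsumura1987, §26] -/
def pderiv (h : IsPBasis p t) (i : ι) : Derivation ℤ R R :=
  Derivation.mk' (AddMonoidHom.toIntLinearMap ⟨⟨h.pderivFun i, by simp [pderivFun]⟩, h.pderivFun_add i⟩)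
    fun x y => by
      change h.pderivFun i (x * y) = x • h.pderivFun i y + y • h.pderivFun i x
      rw [smul_eq_mul, smul_eq_mul, pderivFun_mul]

/-- `pderiv` is `pderivFun` as a function. [folklore] -/
@[simp] theorem pderiv_apply (h : IsPBasis p t) (i : ι) (x : R) : h.pderiv i x = h.pderivFun i x := rfl

/-- `∂_i (c ^ p * x) = c ^ p * ∂_i x`. [folklore] -/
theorem pderiv_pow_mul (h : IsPBasis p t) (i : ι) (c x : R) :
    h.pderiv i (c ^ p * x) = c ^ p * h.pderiv i x :=
  h.pderivFun_pow_mul i c x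

/-- `∂_i` kills `p`-th powers. [folklore] -/
theorem pderiv_pow_char (h : IsPBasis p t) (i : ι) (c : R) : h.pderiv i (c ^ p) = 0 := by
  have := h.pderiv_pow_mul i c 1
  rwa [mul_one, Derivation.map_one_eq_zero, mul_zero] at this

/-- `∂_i (t^α) = α_i * t^(α - e_i)`. [cite: Matsumura1987, §26] -/
theorem pderiv_pMonomial (h : IsPBasis p t) (i : ι) (α : ι → Fin p) :
    h.pderiv i (pMonomial p t α) = ((α i : ℕ) : R) * pMonomial p t (α - Pi.single i 1) :=
  h.pderivFun_pMonomial i α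

/-- `∂_i (∏ t_j ^ e_j) = e_i * ∏ t_j ^ (e - δ_i)_j`. [cite: Matsumura1987, §26] -/
theorem pderiv_prodPow (h : IsPBasis p t) (i : ι) (e : ι → ℕ) :
    h.pderiv i (prodPow t e) = ((e i : ℕ) : R) * prodPow t (e - Pi.single i 1) :=
  h.pderivFun_prodPow i e

/-- **Duality**: `∂_i (t i) = 1`. [cite: Matsumura1987, §26] -/
theorem pderiv_apply_self (h : IsPBasis p t) (i : ι) : h.pderiv i (t i) = 1 := by
  rw [← prodPow_single_one t i, pderiv_prodPow, Pi.single_eq_same, Nat.cast_one, one_mul,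
    show (Pi.single i 1 - Pi.single i 1 : ι → ℕ) = 0 from funext fun j => Nat.sub_self _, prodPow_zero]

/-- **Duality**: `∂_i (t j) = 0` for `j ≠ i`. [cite: Matsumura1987, §26] -/
theorem pderiv_apply_of_ne (h : IsPBasis p t) {i j : ι} (hij : j ≠ i) : h.pderiv i (t j) = 0 := by
  rw [← prodPow_single_one t j, pderiv_prodPow, Pi.single_eq_of_ne hij.symm, Nat.cast_zero, zero_mul]

/-- **Duality**, Kronecker form: `∂_i (t j) = δ_ij`. [cite: Matsumura1987, §26] -/
theorem pderiv_apply_eq_ite (h : IsPBasis p t) (i j : ι) : h.pderiv i (t j) = if i = j then 1 else 0 := by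
  split_ifs with hij
  · subst hij; exact h.pderiv_apply_self i
  · exact h.pderiv_apply_of_ne (Ne.symm hij)

end IsPBasis

end Literature.NumberTheory.GaloisCohomology

end
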